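import Mathlib
import HarnessLib

/-!
# Powers of (sub-)Markov kernels on a countable state space — elementary kernel algebra

Support file for the proof of Bass–Levin 2002, Theorem 1.1
(`Literature.Probability.Process.bassLevin_thm_1_1`, file `StableLikeJumpChain.lean`).

We work with a nonnegative kernel `K : S → S → ℝ` with summable rows of mass `≤ 1`
(sub-Markov) and with a sequence `Q : ℕ → S → S → ℝ` satisfying the right Chapman–Kolmogorov
recursion `Q 0 x y = 𝟙{x=y}`, `Q (n+1) x y = ∑' z, Q n x z * K z y` — exactly the recursion defining
`Literature.Probability.Process.jumpChainProb`. No new definitions are introduced: "`Q` is the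
sequence of powers of `K`" is carried as the pair of hypotheses `hQ0`, `hQ`, so that the results
apply verbatim to `jumpChainProb C`, to powers of truncated kernels, and to killed kernels.

Contents: nonnegativity, row sums, the bound `Q n x y ≤ 1`, Chapman–Kolmogorov
(`kpow_add`), the left recursion, monotonicity in the kernel, reversibility
(`μ x * Q n x y = μ y * Q n y x`), conservation of mass for Markov kernels, and the discrete
Duhamel / Meyer decomposition of the powers of `K₁ + K₂` along the first use of `K₂`
(`kpow_meyer`), whose special case `K₂ = K · 𝟙_{Bᶜ}` is the first-exit decomposition.

All statements are standard facts about Markov chains on countable state spaces. [folklore]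

## References
* R. F. Bass, D. A. Levin, *Transition probabilities for symmetric jump processes*,
  Trans. Amer. Math. Soc. 354 (2002) 2933–2953 (the recursion (1.1), p. 2933; §2 p. 2935).
-/

noncomputable section

namespace Literature.Probability.Process

open scoped BigOperators

section TsumSwap

variable {S T : Type*}

/-- Tonelli for nonnegative double series (summability part): if `f ≥ 0`, every `f z ·` is summable
and `z ↦ ∑' y, f z y` is summable, then the transposed sections `fun z ↦ f z y` are summable and so
is `y ↦ ∑' z, f z y`. [folklore] -/
theorem summable_swap_of_nonneg {f : S → T → ℝ} (hf : ∀ z y, 0 ≤ f z y)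
    (h1 : ∀ z, Summable (f z)) (h2 : Summable fun z => ∑' y, f z y) :
    (∀ y, Summable fun z => f z y) ∧ Summable fun y => ∑' z, f z y := by
  have hu : Summable (Function.uncurry f) :=
    (summable_prod_of_nonneg (fun p => hf p.1 p.2)).2 ⟨h1, h2⟩
  have hs : Summable (fun p : T × S => f p.2 p.1) := hu.prod_symm
  exact (summable_prod_of_nonneg (fun p => hf p.2 p.1)).1 hs

/-- Tonelli for nonnegative double series (uncurried summability). [folklore] -/
theorem summable_uncurry_of_nonneg {f : S → T → ℝ} (hf : ∀ z y, 0 ≤ f z y)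
    (h1 : ∀ z, Summable (f z)) (h2 : Summable fun z => ∑' y, f z y) :
    Summable (Function.uncurry f) :=
  (summable_prod_of_nonneg (fun p => hf p.1 p.2)).2 ⟨h1, h2⟩

/-- Tonelli for nonnegative double series (interchange of the order of summation). [folklore] -/
theorem tsum_swap_of_nonneg {f : S → T → ℝ} (hf : ∀ z y, 0 ≤ f z y)
    (h1 : ∀ z, Summable (f z)) (h2 : Summable fun z => ∑' y, f z y) :
    ∑' y, ∑' z, f z y = ∑' z, ∑' y, f z y :=
  (summable_uncurry_of_nonneg hf h1 h2).tsum_comm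

end TsumSwap

section Kernel

variable {S : Type*} [DecidableEq S] {K : S → S → ℝ} {Q : ℕ → S → S → ℝ}

omit [DecidableEq S] in
/-- A single entry of a nonnegative sub-Markov kernel is at most `1`. [folklore] -/
theorem kernel_le_one (hK : ∀ x y, 0 ≤ K x y) (hKs : ∀ x, Summable (K x))
    (hK1 : ∀ x, ∑' y, K x y ≤ 1) (x y : S) : K x y ≤ 1 :=
  ((hKs x).le_tsum y (fun z _ => hK x z)).trans (hK1 x)

/-- Powers of a nonnegative kernel are nonnegative. [folklore] -/
theorem kpow_nonneg (hK : ∀ x y, 0 ≤ K x y)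
    (hQ0 : ∀ x y, Q 0 x y = if x = y then 1 else 0)
    (hQ : ∀ n x y, Q (n + 1) x y = ∑' z, Q n x z * K z y) (n : ℕ) (x y : S) :
    0 ≤ Q n x y := by
  induction n generalizing y with
  | zero => rw [hQ0]; split_ifs <;> norm_num
  | succ n ih => rw [hQ]; exact tsum_nonneg fun z => mul_nonneg (ih z) (hK z y)

/-- Rows of the powers of a sub-Markov kernel are summable with mass at most `1`. [folklore] -/
theorem kpow_row (hK : ∀ x y, 0 ≤ K x y) (hKs : ∀ x, Summable (K x))
    (hK1 : ∀ x, ∑' y, K x y ≤ 1)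
    (hQ0 : ∀ x y, Q 0 x y = if x = y then 1 else 0)
    (hQ : ∀ n x y, Q (n + 1) x y = ∑' z, Q n x z * K z y) (n : ℕ) (x : S) :
    Summable (Q n x) ∧ ∑' y, Q n x y ≤ 1 := by
  induction n with
  | zero =>
    have h0 : Q 0 x = fun y => if y = x then (1 : ℝ) else 0 := by
      funext y; rw [hQ0]; by_cases h : x = y <;> simp [h, eq_comm]
    refine ⟨?_, ?_⟩
    · rw [h0]; exact (hasSum_ite_eq x (1 : ℝ)).summable
    · rw [h0, tsum_ite_eq]
  | succ n ih =>
    obtain ⟨ihs, ih1⟩ := ih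
    have hnn : ∀ z y, 0 ≤ Q n x z * K z y :=
      fun z y => mul_nonneg (kpow_nonneg hK hQ0 hQ n x z) (hK z y)
    have h1 : ∀ z, Summable fun y => Q n x z * K z y := fun z => (hKs z).mul_left _
    have h2 : Summable fun z => ∑' y, Q n x z * K z y := by
      refine Summable.of_nonneg_of_le (fun z => tsum_nonneg (hnn z)) (fun z => ?_) ihs
      rw [tsum_mul_left]
      exact mul_le_of_le_one_right (kpow_nonneg hK hQ0 hQ n x z) (hK1 z)
    obtain ⟨-, hsum⟩ := summable_swap_of_nonneg hnn h1 h2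
    have hfun : Q (n + 1) x = fun y => ∑' z, Q n x z * K z y := by funext y; rw [hQ]
    refine ⟨by rw [hfun]; exact hsum, ?_⟩
    rw [hfun, tsum_swap_of_nonneg hnn h1 h2]
    calc ∑' z, ∑' y, Q n x z * K z y ≤ ∑' z, Q n x z := by
          refine Summable.tsum_le_tsum (fun z => ?_) h2 ihs
          rw [tsum_mul_left]
          exact mul_le_of_le_one_right (kpow_nonneg hK hQ0 hQ n x z) (hK1 z)
      _ ≤ 1 := ih1

/-- Rows of kernel powers are summable. [folklore] -/
theorem kpow_summable (hK : ∀ x y, 0 ≤ K x y) (hKs : ∀ x, Summable (K x))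
    (hK1 : ∀ x, ∑' y, K x y ≤ 1)
    (hQ0 : ∀ x y, Q 0 x y = if x = y then 1 else 0)
    (hQ : ∀ n x y, Q (n + 1) x y = ∑' z, Q n x z * K z y) (n : ℕ) (x : S) :
    Summable (Q n x) :=
  (kpow_row hK hKs hK1 hQ0 hQ n x).1

/-- Row sums of kernel powers are at most `1`. [folklore] -/
theorem kpow_tsum_le_one (hK : ∀ x y, 0 ≤ K x y) (hKs : ∀ x, Summable (K x))
    (hK1 : ∀ x, ∑' y, K x y ≤ 1)
    (hQ0 : ∀ x y, Q 0 x y = if x = y then 1 else 0)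
    (hQ : ∀ n x y, Q (n + 1) x y = ∑' z, Q n x z * K z y) (n : ℕ) (x : S) :
    ∑' y, Q n x y ≤ 1 :=
  (kpow_row hK hKs hK1 hQ0 hQ n x).2

/-- Entries of kernel powers are at most `1`. [folklore] -/
theorem kpow_le_one (hK : ∀ x y, 0 ≤ K x y) (hKs : ∀ x, Summable (K x))
    (hK1 : ∀ x, ∑' y, K x y ≤ 1)
    (hQ0 : ∀ x y, Q 0 x y = if x = y then 1 else 0)
    (hQ : ∀ n x y, Q (n + 1) x y = ∑' z, Q n x z * K z y) (n : ℕ) (x y : S) :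
    Q n x y ≤ 1 :=
  ((kpow_summable hK hKs hK1 hQ0 hQ n x).le_tsum y
    (fun z _ => kpow_nonneg hK hQ0 hQ n x z)).trans (kpow_tsum_le_one hK hKs hK1 hQ0 hQ n x)

/-- Finite partial row sums of kernel powers are at most `1`. [folklore] -/
theorem kpow_sum_le_one (hK : ∀ x y, 0 ≤ K x y) (hKs : ∀ x, Summable (K x))
    (hK1 : ∀ x, ∑' y, K x y ≤ 1)
    (hQ0 : ∀ x y, Q 0 x y = if x = y then 1 else 0)
    (hQ : ∀ n x y, Q (n + 1) x y = ∑' z, Q n x z * K z y) (n : ℕ) (x : S) (s : Finset S) :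
    ∑ y ∈ s, Q n x y ≤ 1 :=
  ((kpow_summable hK hKs hK1 hQ0 hQ n x).sum_le_tsum s
    (fun z _ => kpow_nonneg hK hQ0 hQ n x z)).trans (kpow_tsum_le_one hK hKs hK1 hQ0 hQ n x)

/-- The first power is the kernel itself. [folklore] -/
theorem kpow_one (hQ0 : ∀ x y, Q 0 x y = if x = y then 1 else 0)
    (hQ : ∀ n x y, Q (n + 1) x y = ∑' z, Q n x z * K z y) (x y : S) :
    Q 1 x y = K x y := by
  rw [hQ]
  have : (fun z => Q 0 x z * K z y) = fun z => if z = x then K z y else 0 := by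
    funext z; rw [hQ0]; by_cases h : x = z
    · subst h; simp
    · simp [h, Ne.symm h]
  rw [this, tsum_ite_eq]

/-- **Chapman–Kolmogorov**: `Q (m+n) x y = ∑' z, Q m x z * Q n z y`. [folklore] -/
theorem kpow_add (hK : ∀ x y, 0 ≤ K x y) (hKs : ∀ x, Summable (K x))
    (hK1 : ∀ x, ∑' y, K x y ≤ 1)
    (hQ0 : ∀ x y, Q 0 x y = if x = y then 1 else 0)
    (hQ : ∀ n x y, Q (n + 1) x y = ∑' z, Q n x z * K z y) (m n : ℕ) (x y : S) :
    Q (m + n) x y = ∑' z, Q m x z * Q n z y := by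
  induction n generalizing y with
  | zero =>
    have : (fun z => Q m x z * Q 0 z y) = fun z => if z = y then Q m x z else 0 := by
      funext z; rw [hQ0]; by_cases h : z = y
      · subst h; simp
      · simp [h]
    rw [Nat.add_zero, this, tsum_ite_eq]
  | succ n ih =>
    rw [← Nat.add_assoc, hQ]
    -- g z w := Q m x z * (Q n z w * K w y)
    have hQn : ∀ z, 0 ≤ Q m x z := kpow_nonneg hK hQ0 hQ m x
    have hnn : ∀ z w, 0 ≤ Q m x z * (Q n z w * K w y) := fun z w =>
      mul_nonneg (hQn z) (mul_nonneg (kpow_nonneg hK hQ0 hQ n z w) (hK w y))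
    have hKle : ∀ w, K w y ≤ 1 := fun w => kernel_le_one hK hKs hK1 w y
    have h1 : ∀ z, Summable fun w => Q m x z * (Q n z w * K w y) := by
      intro z
      refine ((kpow_summable hK hKs hK1 hQ0 hQ n z).mul_left (Q m x z)).of_nonneg_of_le
        (hnn z) (fun w => ?_)
      exact mul_le_mul_of_nonneg_left
        (mul_le_of_le_one_right (kpow_nonneg hK hQ0 hQ n z w) (hKle w)) (hQn z)
    have h2 : Summable fun z => ∑' w, Q m x z * (Q n z w * K w y) := by
      refine (kpow_summable hK hKs hK1 hQ0 hQ m x).of_nonneg_of_le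
        (fun z => tsum_nonneg (hnn z)) (fun z => ?_)
      rw [tsum_mul_left, ← hQ]
      exact mul_le_of_le_one_right (hQn z) (kpow_le_one hK hKs hK1 hQ0 hQ (n + 1) z y)
    calc ∑' w, Q (m + n) x w * K w y
        = ∑' w, ∑' z, Q m x z * (Q n z w * K w y) := by
          refine tsum_congr fun w => ?_
          rw [ih w, ← tsum_mul_right]
          exact tsum_congr fun z => by ring
      _ = ∑' z, ∑' w, Q m x z * (Q n z w * K w y) := tsum_swap_of_nonneg hnn h1 h2
      _ = ∑' z, Q m x z * Q (n + 1) z y := by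
          refine tsum_congr fun z => ?_
          rw [tsum_mul_left, ← hQ]

/-- Left recursion: `Q (n+1) x y = ∑' z, K x z * Q n z y`. [folklore] -/
theorem kpow_succ_left (hK : ∀ x y, 0 ≤ K x y) (hKs : ∀ x, Summable (K x))
    (hK1 : ∀ x, ∑' y, K x y ≤ 1)
    (hQ0 : ∀ x y, Q 0 x y = if x = y then 1 else 0)
    (hQ : ∀ n x y, Q (n + 1) x y = ∑' z, Q n x z * K z y) (n : ℕ) (x y : S) :
    Q (n + 1) x y = ∑' z, K x z * Q n z y := by
  rw [Nat.add_comm, kpow_add hK hKs hK1 hQ0 hQ 1 n x y]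
  exact tsum_congr fun z => by rw [kpow_one hQ0 hQ]

/-- The function `z ↦ K x z * Q n z y` (one step, then `n` steps) is summable. [folklore] -/
theorem summable_kernel_mul_kpow (hK : ∀ x y, 0 ≤ K x y) (hKs : ∀ x, Summable (K x))
    (hK1 : ∀ x, ∑' y, K x y ≤ 1)
    (hQ0 : ∀ x y, Q 0 x y = if x = y then 1 else 0)
    (hQ : ∀ n x y, Q (n + 1) x y = ∑' z, Q n x z * K z y) (n : ℕ) (x y : S) :
    Summable fun z => K x z * Q n z y :=
  (hKs x).of_nonneg_of_le (fun z => mul_nonneg (hK x z) (kpow_nonneg hK hQ0 hQ n z y))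
    (fun z => mul_le_of_le_one_right (hK x z) (kpow_le_one hK hKs hK1 hQ0 hQ n z y))

/-- The function `z ↦ Q m x z * Q n z y` is summable. [folklore] -/
theorem summable_kpow_mul_kpow (hK : ∀ x y, 0 ≤ K x y) (hKs : ∀ x, Summable (K x))
    (hK1 : ∀ x, ∑' y, K x y ≤ 1)
    (hQ0 : ∀ x y, Q 0 x y = if x = y then 1 else 0)
    (hQ : ∀ n x y, Q (n + 1) x y = ∑' z, Q n x z * K z y) (m n : ℕ) (x y : S) :
    Summable fun z => Q m x z * Q n z y :=
  (kpow_summable hK hKs hK1 hQ0 hQ m x).of_nonneg_of_le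
    (fun z => mul_nonneg (kpow_nonneg hK hQ0 hQ m x z) (kpow_nonneg hK hQ0 hQ n z y))
    (fun z => mul_le_of_le_one_right (kpow_nonneg hK hQ0 hQ m x z)
      (kpow_le_one hK hKs hK1 hQ0 hQ n z y))

/-- A single path of length two bounds the two-step kernel from below:
`Q m x z * Q n z y ≤ Q (m+n) x y`. [folklore] -/
theorem kpow_mul_kpow_le_kpow_add (hK : ∀ x y, 0 ≤ K x y) (hKs : ∀ x, Summable (K x))
    (hK1 : ∀ x, ∑' y, K x y ≤ 1)
    (hQ0 : ∀ x y, Q 0 x y = if x = y then 1 else 0)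
    (hQ : ∀ n x y, Q (n + 1) x y = ∑' z, Q n x z * K z y) (m n : ℕ) (x z y : S) :
    Q m x z * Q n z y ≤ Q (m + n) x y := by
  rw [kpow_add hK hKs hK1 hQ0 hQ m n x y]
  exact (summable_kpow_mul_kpow hK hKs hK1 hQ0 hQ m n x y).le_tsum z
    (fun w _ => mul_nonneg (kpow_nonneg hK hQ0 hQ m x w) (kpow_nonneg hK hQ0 hQ n w y))

/-- **Monotonicity in the kernel**: if `0 ≤ K ≤ K'` entrywise (with `K'` sub-Markov) then the
powers satisfy `Q n x y ≤ Q' n x y`. [folklore] -/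
theorem kpow_mono_kernel {K' : S → S → ℝ} {Q' : ℕ → S → S → ℝ}
    (hK : ∀ x y, 0 ≤ K x y) (hKK' : ∀ x y, K x y ≤ K' x y)
    (hK's : ∀ x, Summable (K' x)) (hK'1 : ∀ x, ∑' y, K' x y ≤ 1)
    (hQ0 : ∀ x y, Q 0 x y = if x = y then 1 else 0)
    (hQ : ∀ n x y, Q (n + 1) x y = ∑' z, Q n x z * K z y)
    (hQ'0 : ∀ x y, Q' 0 x y = if x = y then 1 else 0)
    (hQ' : ∀ n x y, Q' (n + 1) x y = ∑' z, Q' n x z * K' z y) (n : ℕ) (x y : S) :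
    Q n x y ≤ Q' n x y := by
  have hK' : ∀ x y, 0 ≤ K' x y := fun x y => (hK x y).trans (hKK' x y)
  have hKs : ∀ x, Summable (K x) := fun x => (hK's x).of_nonneg_of_le (hK x) (hKK' x)
  have hK1 : ∀ x, ∑' y, K x y ≤ 1 := fun x =>
    (Summable.tsum_le_tsum (hKK' x) (hKs x) (hK's x)).trans (hK'1 x)
  induction n generalizing y with
  | zero => rw [hQ0, hQ'0]
  | succ n ih =>
    rw [hQ, hQ']
    refine Summable.tsum_le_tsum (fun z => ?_) ?_ ?_
    · exact mul_le_mul (ih z) (hKK' z y) (hK z y) (kpow_nonneg hK' hQ'0 hQ' n x z)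
    · exact (kpow_summable hK hKs hK1 hQ0 hQ n x).of_nonneg_of_le
        (fun z => mul_nonneg (kpow_nonneg hK hQ0 hQ n x z) (hK z y))
        (fun z => mul_le_of_le_one_right (kpow_nonneg hK hQ0 hQ n x z)
          (kernel_le_one hK hKs hK1 z y))
    · exact (kpow_summable hK' hK's hK'1 hQ'0 hQ' n x).of_nonneg_of_le
        (fun z => mul_nonneg (kpow_nonneg hK' hQ'0 hQ' n x z) (hK' z y))
        (fun z => mul_le_of_le_one_right (kpow_nonneg hK' hQ'0 hQ' n x z)
          (kernel_le_one hK' hK's hK'1 z y))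

/-- **Reversibility is inherited by the powers**: if `μ x * K x y = μ y * K y x` then
`μ x * Q n x y = μ y * Q n y x`. Bass–Levin 2002, §2 p. 2935 ("it can be seen by induction that
`C_x p(n,x,y)` is symmetric", proof of Thm 4.3). [cite: BassLevin2002, §4 proof of Thm 4.3] -/
theorem kpow_reversible {μ : S → ℝ} (hK : ∀ x y, 0 ≤ K x y) (hKs : ∀ x, Summable (K x))
    (hK1 : ∀ x, ∑' y, K x y ≤ 1)
    (hQ0 : ∀ x y, Q 0 x y = if x = y then 1 else 0)
    (hQ : ∀ n x y, Q (n + 1) x y = ∑' z, Q n x z * K z y)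
    (hμK : ∀ x y, μ x * K x y = μ y * K y x) (n : ℕ) (x y : S) :
    μ x * Q n x y = μ y * Q n y x := by
  induction n generalizing x y with
  | zero =>
    rw [hQ0, hQ0]
    by_cases h : x = y
    · subst h; rfl
    · simp [h, Ne.symm h]
  | succ n ih =>
    rw [hQ n x y, kpow_succ_left hK hKs hK1 hQ0 hQ n y x, ← tsum_mul_left, ← tsum_mul_left]
    refine tsum_congr fun z => ?_
    calc μ x * (Q n x z * K z y) = (μ x * Q n x z) * K z y := by ring
      _ = (μ z * Q n z x) * K z y := by rw [ih x z]
      _ = (μ z * K z y) * Q n z x := by ring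
      _ = (μ y * K y z) * Q n z x := by rw [hμK z y]
      _ = μ y * (K y z * Q n z x) := by ring

/-- For a Markov kernel (rows summing to `1`) the powers are Markov. [folklore] -/
theorem kpow_hasSum_one (hK : ∀ x y, 0 ≤ K x y) (hKh : ∀ x, HasSum (K x) 1)
    (hQ0 : ∀ x y, Q 0 x y = if x = y then 1 else 0)
    (hQ : ∀ n x y, Q (n + 1) x y = ∑' z, Q n x z * K z y) (n : ℕ) (x : S) :
    HasSum (Q n x) 1 := by
  have hKs : ∀ x, Summable (K x) := fun x => (hKh x).summable
  have hK1 : ∀ x, ∑' y, K x y ≤ 1 := fun x => ((hKh x).tsum_eq).le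
  induction n with
  | zero =>
    have h0 : Q 0 x = fun y => if y = x then (1 : ℝ) else 0 := by
      funext y; rw [hQ0]; by_cases h : x = y <;> simp [h, eq_comm]
    rw [h0]; exact hasSum_ite_eq x 1
  | succ n ih =>
    have hs := kpow_summable hK hKs hK1 hQ0 hQ (n + 1) x
    rw [Summable.hasSum_iff hs]
    have hnn : ∀ z y, 0 ≤ Q n x z * K z y :=
      fun z y => mul_nonneg (kpow_nonneg hK hQ0 hQ n x z) (hK z y)
    have h1 : ∀ z, Summable fun y => Q n x z * K z y := fun z => (hKs z).mul_left _
    have h2 : Summable fun z => ∑' y, Q n x z * K z y := by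
      refine (kpow_summable hK hKs hK1 hQ0 hQ n x).of_nonneg_of_le
        (fun z => tsum_nonneg (hnn z)) (fun z => ?_)
      rw [tsum_mul_left]
      exact mul_le_of_le_one_right (kpow_nonneg hK hQ0 hQ n x z) (hK1 z)
    have hfun : Q (n + 1) x = fun y => ∑' z, Q n x z * K z y := by funext y; rw [hQ]
    rw [hfun, tsum_swap_of_nonneg hnn h1 h2]
    calc ∑' z, ∑' y, Q n x z * K z y = ∑' z, Q n x z := by
          refine tsum_congr fun z => ?_
          rw [tsum_mul_left, (hKh z).tsum_eq, mul_one]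
      _ = 1 := ih.tsum_eq

/-- For a Markov kernel the row sums of the powers equal `1`. [folklore] -/
theorem kpow_tsum_eq_one (hK : ∀ x y, 0 ≤ K x y) (hKh : ∀ x, HasSum (K x) 1)
    (hQ0 : ∀ x y, Q 0 x y = if x = y then 1 else 0)
    (hQ : ∀ n x y, Q (n + 1) x y = ∑' z, Q n x z * K z y) (n : ℕ) (x : S) :
    ∑' y, Q n x y = 1 :=
  (kpow_hasSum_one hK hKh hQ0 hQ n x).tsum_eq

/-- Column sums of a reversible sub-Markov kernel power, weighted by the symmetrizing measure:
`∑' x, μ x * Q n x y ≤ μ y` (and the family is summable). [folklore] -/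
theorem kpow_column (hK : ∀ x y, 0 ≤ K x y) (hKs : ∀ x, Summable (K x))
    (hK1 : ∀ x, ∑' y, K x y ≤ 1)
    (hQ0 : ∀ x y, Q 0 x y = if x = y then 1 else 0)
    (hQ : ∀ n x y, Q (n + 1) x y = ∑' z, Q n x z * K z y)
    {μ : S → ℝ} (hμ : ∀ x, 0 ≤ μ x) (hμK : ∀ x y, μ x * K x y = μ y * K y x) (n : ℕ) (y : S) :
    Summable (fun x => μ x * Q n x y) ∧ ∑' x, μ x * Q n x y ≤ μ y := by
  have heq : (fun x => μ x * Q n x y) = fun x => μ y * Q n y x := by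
    funext x; exact kpow_reversible hK hKs hK1 hQ0 hQ hμK n x y
  rw [heq]
  refine ⟨(kpow_summable hK hKs hK1 hQ0 hQ n y).mul_left _, ?_⟩
  rw [tsum_mul_left]
  exact mul_le_of_le_one_right (hμ y) (kpow_tsum_le_one hK hKs hK1 hQ0 hQ n y)

/-- Pointwise bound for reversible kernels with comparable symmetrizing weights:
`Q n x y ≤ μ y / μ x` (from `μ x Q n x y = μ y Q n y x ≤ μ y`). [folklore] -/
theorem kpow_le_div (hK : ∀ x y, 0 ≤ K x y) (hKs : ∀ x, Summable (K x))
    (hK1 : ∀ x, ∑' y, K x y ≤ 1)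
    (hQ0 : ∀ x y, Q 0 x y = if x = y then 1 else 0)
    (hQ : ∀ n x y, Q (n + 1) x y = ∑' z, Q n x z * K z y)
    {μ : S → ℝ} (hμ : ∀ x, 0 < μ x) (hμK : ∀ x y, μ x * K x y = μ y * K y x) (n : ℕ) (x y : S) :
    Q n x y ≤ μ y / μ x := by
  rw [le_div_iff₀ (hμ x), mul_comm, kpow_reversible hK hKs hK1 hQ0 hQ hμK n x y]
  exact mul_le_of_le_one_right (hμ y).le (kpow_le_one hK hKs hK1 hQ0 hQ n y x)

/-- **Discrete Duhamel / Meyer decomposition.** Let `K = K₁ + K₂` entrywise with `K₁, K₂ ≥ 0`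
and `K` sub-Markov, and let `Q`, `R` be the powers of `K`, `K₁`. Decomposing a path according to
the first step that uses `K₂`,
`Q n x y = R n x y + ∑_{k<n} ∑' z, (∑' w, R k x w * K₂ w z) * Q (n-1-k) z y`.
With `K₂ w z = K w z 𝟙_{Bᶜ}(z)` this is the first-exit decomposition from `B`; with
`K₂ = ` "jumps longer than `ρ`" it is Meyer's construction used in Bass–Levin §2 (Prop. 2.6) and
§4 (Props. 4.4–4.6). [folklore] -/
theorem kpow_meyer {K₁ K₂ : S → S → ℝ} {R : ℕ → S → S → ℝ}
    (hK₁ : ∀ x y, 0 ≤ K₁ x y) (hK₂ : ∀ x y, 0 ≤ K₂ x y) (hK12 : ∀ x y, K x y = K₁ x y + K₂ x y)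
    (hKs : ∀ x, Summable (K x)) (hK1 : ∀ x, ∑' y, K x y ≤ 1)
    (hQ0 : ∀ x y, Q 0 x y = if x = y then 1 else 0)
    (hQ : ∀ n x y, Q (n + 1) x y = ∑' z, Q n x z * K z y)
    (hR0 : ∀ x y, R 0 x y = if x = y then 1 else 0)
    (hR : ∀ n x y, R (n + 1) x y = ∑' z, R n x z * K₁ z y) (n : ℕ) (x y : S) :
    Q n x y = R n x y +
      ∑ k ∈ Finset.range n, ∑' z, (∑' w, R k x w * K₂ w z) * Q (n - 1 - k) z y := by
  have hK : ∀ x y, 0 ≤ K x y := fun x y => by rw [hK12]; exact add_nonneg (hK₁ x y) (hK₂ x y)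
  have hK₁le : ∀ x y, K₁ x y ≤ K x y := fun x y => by rw [hK12]; linarith [hK₂ x y]
  have hK₂le : ∀ x y, K₂ x y ≤ K x y := fun x y => by rw [hK12]; linarith [hK₁ x y]
  have hK₁s : ∀ x, Summable (K₁ x) := fun x => (hKs x).of_nonneg_of_le (hK₁ x) (hK₁le x)
  have hK₂s : ∀ x, Summable (K₂ x) := fun x => (hKs x).of_nonneg_of_le (hK₂ x) (hK₂le x)
  have hK₁1 : ∀ x, ∑' y, K₁ x y ≤ 1 := fun x =>
    (Summable.tsum_le_tsum (hK₁le x) (hK₁s x) (hKs x)).trans (hK1 x)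
  have hK₂1 : ∀ x, ∑' y, K₂ x y ≤ 1 := fun x =>
    (Summable.tsum_le_tsum (hK₂le x) (hK₂s x) (hKs x)).trans (hK1 x)
  have hRnn : ∀ k x w, 0 ≤ R k x w := kpow_nonneg hK₁ hR0 hR
  have hQnn : ∀ k x w, 0 ≤ Q k x w := kpow_nonneg hK hQ0 hQ
  -- ν k z := ∑' w, R k x w * K₂ w z is a nonnegative summable family of mass ≤ 1
  have hνnn : ∀ k z, 0 ≤ ∑' w, R k x w * K₂ w z :=
    fun k z => tsum_nonneg fun w => mul_nonneg (hRnn k x w) (hK₂ w z)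
  have hν1 : ∀ k w, Summable fun z => R k x w * K₂ w z := fun k w => (hK₂s w).mul_left _
  have hν2 : ∀ k, Summable fun w => ∑' z, R k x w * K₂ w z := by
    intro k
    refine (kpow_summable hK₁ hK₁s hK₁1 hR0 hR k x).of_nonneg_of_le
      (fun w => tsum_nonneg fun z => mul_nonneg (hRnn k x w) (hK₂ w z)) (fun w => ?_)
    rw [tsum_mul_left]
    exact mul_le_of_le_one_right (hRnn k x w) (hK₂1 w)
  have hνs : ∀ k, Summable fun z => ∑' w, R k x w * K₂ w z := fun k =>
    (summable_swap_of_nonneg (fun w z => mul_nonneg (hRnn k x w) (hK₂ w z)) (hν1 k) (hν2 k)).2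
  -- key identity: ∑' u, (∑' z, ν z * Q j z u) * K u y = ∑' z, ν z * Q (j+1) z y
  have hstep : ∀ (y : S) (ν : S → ℝ), (∀ z, 0 ≤ ν z) → Summable ν → ∀ j,
      ∑' u, (∑' z, ν z * Q j z u) * K u y = ∑' z, ν z * Q (j + 1) z y := by
    intro y ν hν0 hνs j
    have hnn : ∀ z u, 0 ≤ ν z * (Q j z u * K u y) :=
      fun z u => mul_nonneg (hν0 z) (mul_nonneg (hQnn j z u) (hK u y))
    have h1 : ∀ z, Summable fun u => ν z * (Q j z u * K u y) := by
      intro z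
      refine ((kpow_summable hK hKs hK1 hQ0 hQ j z).mul_left (ν z)).of_nonneg_of_le (hnn z)
        (fun u => mul_le_mul_of_nonneg_left ?_ (hν0 z))
      exact mul_le_of_le_one_right (hQnn j z u) (kernel_le_one hK hKs hK1 u y)
    have h2 : Summable fun z => ∑' u, ν z * (Q j z u * K u y) := by
      refine hνs.of_nonneg_of_le (fun z => tsum_nonneg (hnn z)) (fun z => ?_)
      rw [tsum_mul_left, ← hQ]
      exact mul_le_of_le_one_right (hν0 z) (kpow_le_one hK hKs hK1 hQ0 hQ (j + 1) z y)
    calc ∑' u, (∑' z, ν z * Q j z u) * K u y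
        = ∑' u, ∑' z, ν z * (Q j z u * K u y) := by
          refine tsum_congr fun u => ?_
          rw [← tsum_mul_right]
          exact tsum_congr fun z => by ring
      _ = ∑' z, ∑' u, ν z * (Q j z u * K u y) := tsum_swap_of_nonneg hnn h1 h2
      _ = ∑' z, ν z * Q (j + 1) z y := by
          refine tsum_congr fun z => ?_
          rw [tsum_mul_left, ← hQ]
  induction n generalizing y with
  | zero => simp [hQ0, hR0]
  | succ n ih =>
    -- summability facts for splitting the (n+1)-step sum
    have hsRK : Summable fun u => R n x u * K u y :=
      (kpow_summable hK₁ hK₁s hK₁1 hR0 hR n x).of_nonneg_of_le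
        (fun u => mul_nonneg (hRnn n x u) (hK u y))
        (fun u => mul_le_of_le_one_right (hRnn n x u) (kernel_le_one hK hKs hK1 u y))
    have hsRK₁ : Summable fun u => R n x u * K₁ u y :=
      hsRK.of_nonneg_of_le (fun u => mul_nonneg (hRnn n x u) (hK₁ u y))
        (fun u => mul_le_mul_of_nonneg_left (hK₁le u y) (hRnn n x u))
    have hsRK₂ : Summable fun u => R n x u * K₂ u y :=
      hsRK.of_nonneg_of_le (fun u => mul_nonneg (hRnn n x u) (hK₂ u y))
        (fun u => mul_le_mul_of_nonneg_left (hK₂le u y) (hRnn n x u))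
    have hterm : ∀ k ∈ Finset.range n, Summable fun u =>
        (∑' z, (∑' w, R k x w * K₂ w z) * Q (n - 1 - k) z u) * K u y := by
      intro k _
      have hin : ∀ u, ∑' z, (∑' w, R k x w * K₂ w z) * Q (n - 1 - k) z u ≤ Q n x u := by
        intro u
        rw [ih u]
        have hk : k ∈ Finset.range n := ‹_›
        refine le_add_of_nonneg_of_le (hRnn n x u) ?_
        exact Finset.single_le_sum (f := fun k => ∑' z, (∑' w, R k x w * K₂ w z) *
          Q (n - 1 - k) z u) (fun i _ => tsum_nonneg fun z =>
            mul_nonneg (hνnn i z) (hQnn _ z u)) hk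
      refine ((kpow_summable hK hKs hK1 hQ0 hQ n x).of_nonneg_of_le
        (fun u => mul_nonneg (tsum_nonneg fun z => mul_nonneg (hνnn k z) (hQnn _ z u)) (hK u y))
        (fun u => ?_))
      calc (∑' z, (∑' w, R k x w * K₂ w z) * Q (n - 1 - k) z u) * K u y
          ≤ Q n x u * K u y := mul_le_mul_of_nonneg_right (hin u) (hK u y)
        _ ≤ Q n x u := mul_le_of_le_one_right (hQnn n x u) (kernel_le_one hK hKs hK1 u y)
    -- expand Q (n+1) x y using the induction hypothesis
    have hexp : Q (n + 1) x y = ∑' u, R n x u * K₁ u y + ∑' u, R n x u * K₂ u y +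
        ∑ k ∈ Finset.range n,
          ∑' u, (∑' z, (∑' w, R k x w * K₂ w z) * Q (n - 1 - k) z u) * K u y := by
      rw [hQ]
      have : (fun u => Q n x u * K u y) = fun u => (R n x u * K₁ u y + R n x u * K₂ u y) +
          ∑ k ∈ Finset.range n,
            (∑' z, (∑' w, R k x w * K₂ w z) * Q (n - 1 - k) z u) * K u y := by
        funext u
        rw [ih u, hK12 u y, add_mul, Finset.sum_mul]
        ring
      rw [this, Summable.tsum_add (hsRK₁.add hsRK₂) (summable_sum hterm),
        Summable.tsum_add hsRK₁ hsRK₂, Summable.tsum_finsetSum hterm]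
    rw [hexp, hR n x y, Finset.sum_range_succ]
    have hlast : ∑' z, (∑' w, R n x w * K₂ w z) * Q (n + 1 - 1 - n) z y =
        ∑' u, R n x u * K₂ u y := by
      have h0 : n + 1 - 1 - n = 0 := by omega
      rw [h0]
      have : (fun z => (∑' w, R n x w * K₂ w z) * Q 0 z y) =
          fun z => if z = y then ∑' w, R n x w * K₂ w z else 0 := by
        funext z; rw [hQ0]; by_cases h : z = y
        · subst h; simp
        · simp [h]
      rw [this, tsum_ite_eq]
    rw [hlast]
    have hmid : ∀ k ∈ Finset.range n,
        ∑' u, (∑' z, (∑' w, R k x w * K₂ w z) * Q (n - 1 - k) z u) * K u y =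
          ∑' z, (∑' w, R k x w * K₂ w z) * Q (n + 1 - 1 - k) z y := by
      intro k hk
      have hk' : k < n := Finset.mem_range.mp hk
      have h1 : n + 1 - 1 - k = (n - 1 - k) + 1 := by omega
      rw [h1]
      exact hstep y _ (hνnn k) (hνs k) (n - 1 - k)
    rw [Finset.sum_congr rfl hmid]
    ring

end Kernel

end Literature.Probability.Process
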